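import Summits.QuantumAdvantage.QuantumAdvantage.Theorems.LinnikCubicClassGroupsDegreeOnePrimesEscapeRayClassWindowPsi
import Summits.QuantumAdvantage.QuantumAdvantage.Theorems.LinnikCubicClassGroupsDegreeOnePrimesEscapeRayClassLinnik
import Summits.QuantumAdvantage.QuantumAdvantage.Theorems.LinnikCubicClassGroupsDegreeOnePrimesEscapeShortIntervalDHPrelims
import Literature.NumberTheory.LFunctions.ClassGroupUnsmoothing
import HarnessLib

/-!
# Short intervals for cosets of a congruence class group, VI: the Hoheisel–Linnik theorem for narrow ray classes

Topic `Summits/QuantumAdvantage/QuantumAdvantage/Theorems`, cell B2b-1 (linnik-cubic), PART A (gen 23); helper toward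
the crux `DegreeOnePrimesEscape` (stmt-QuantumAdvantage-11543) of route `LinnikCubicClassGroups`.  HONEST FRAMING: the
value of this file is a THEOREM (kernel-checked, GRH-free, Siegel-free) — NOT summit progress (the route still rests on
the hypothesis-type target `PureCubicClassNumberHard`).

For `K` of degree `n > 1`, an abelian Frobenius datum `f : 𝔭 ↦ f 𝔭 ∈ G` killing the narrow ray `mod 𝔪 ≠ 0`
(non-trivial characters non-principal off `𝔪`) with `|G| ≤ Q_𝔪⁴`, `Q_𝔪 = rayCondQ K 𝔪 = |d_K| n^n N𝔪`:
* `fiberPsi_shortInterval_dh_all` — the two-sided `ψ_τ`-form in short intervals with EVERY analytic input discharged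
  (density `rayFam_density`, repulsion `rayRealZero_repulsion`, at the size parameter `Q = Q_𝔪⁴`): either
  `||G|(ψ_τ(x+h) − ψ_τ(x)) − h| ≤ κh`, or (real `ψ₁`, real zero `β₁`)
  `||G|(ψ_τ(x+h) − ψ_τ(x)) − (h − ψ₁(τ) I)| ≤ κ·min(1,(1−β₁) log x)·h`, for `x ≥ Q_𝔪^{4a}`, `x^{1−δ} ≤ h ≤ x`;
* `fiberPsi_shortInterval_lower` — **`|G|(ψ_τ(x+h) − ψ_τ(x)) ≥ c₂ Q_𝔪^{−8} h`** in that range (the flat cosets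
  `ψ₁(τ) = +1` by Deuring–Heilbronn and the effective repulsion);
* `exists_prime_fiber_absNorm_mem_Ioc` — **a prime `𝔭 ∤ 𝔪` with `f 𝔭 = τ` and `x < N𝔭 ≤ x + h` in EVERY coset,
  for every `x ≥ Q_𝔪^L`, `x^{1−δ} ≤ h ≤ x`**; `exists_prime_rayClass_absNorm_mem_Ioc` — the canonical case,
  UNCONDITIONAL: every narrow ray class `mod 𝔪` of every number field of degree `n` contains a prime ideal of norm in
  every interval `(x, x + h]` with `x ≥ (|d_K| n^n N𝔪)^{L(n)}`, `x^{1−δ(n)} ≤ h ≤ x` (Hoheisel–Linnik for ray classes).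
References: G. Hoheisel (1930); [LagariasMontgomeryOdlyzko1979, §7]; [ThornerZaman2019, Thm. 3.1]; [Weiss1983, §6];
A. Balog, K. Ono, J. Number Theory 91 (2001) (Chebotarev in short intervals, fixed field).
-/

noncomputable section

open Complex Real Finset NumberField IsDedekindDomain
open scoped NumberField nonZeroDivisors

namespace Summit.QuantumAdvantage.QuantumAdvantage.Theorems.DegreeOnePrimesEscape

open Literature.NumberTheory.LFunctions Literature.NumberTheory.LFunctions.NumberField
  Literature.NumberTheory.LFunctions.EntireEF Literature.NumberTheory.LFunctions.AbelianDensity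
  Literature.NumberTheory.GaloisRepresentations
open scoped Classical

/-! ### All inputs discharged at the size parameter `Q = Q_𝔪⁴` -/

set_option maxHeartbeats 800000 in
/-- **The two-sided coset prime number theorem in short intervals of the Linnik range, Deuring–Heilbronn-sharp, with
every analytic hypothesis discharged** (see the module docstring). [cite: LagariasMontgomeryOdlyzko1979, §7]
[cite: ThornerZaman2019, Theorem 3.1] -/
theorem fiberPsi_shortInterval_dh_all (n : ℕ) (hn : 1 < n) {κ : ℝ} (hκ : 0 < κ) :
    ∃ δ a c : ℝ, 0 < δ ∧ δ ≤ 1 / 64 ∧ 1 ≤ a ∧ 0 < c ∧ c ≤ 1 / (8 * ((n : ℝ) ^ 2 + 1)) ∧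
    ∀ (K : Type) [Field K] [NumberField K], Module.finrank ℚ K = n →
    ∀ (G : Type) [CommGroup G] [Finite G] (𝔪 : Ideal (𝓞 K)) (f : HeightOneSpectrum (𝓞 K) → G)
      (h𝔪 : 𝔪 ≠ ⊥) (hray : ArtinKillsRay 𝔪 f)
      (hsep : ∀ χ : AddChar (Additive G) ℂ, χ ≠ 0 →
        ∃ v : HeightOneSpectrum (𝓞 K), ¬ 𝔪 ≤ v.asIdeal ∧ χ (Additive.ofMul (f v)) ≠ 1),
      (Nat.card G : ℝ) ≤ rayCondQ K 𝔪 ^ (4 : ℕ) →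
      (∀ x h : ℝ, (rayCondQ K 𝔪 ^ (4 : ℕ)) ^ a ≤ x → x ^ (1 - δ) ≤ h → h ≤ x → ∀ τ : G,
          |(Nat.card G : ℝ) * (fiberPsi 𝔪 f τ (x + h) - fiberPsi 𝔪 f τ x) - h| ≤ κ * h) ∨
      ∃ (ψ₁ : AddChar (Additive G) ℂ) (β₁ : ℝ), rayFamF h𝔪 hray hsep ψ₁ β₁ = 0 ∧
          1 - c / (Real.log (((discr K).natAbs : ℝ) * ((Ideal.absNorm 𝔪 : ℕ) : ℝ)) + Real.log 4) < β₁ ∧ β₁ < 1 ∧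
          ψ₁ + ψ₁ = 0 ∧
        ∀ x h : ℝ, (rayCondQ K 𝔪 ^ (4 : ℕ)) ^ a ≤ x → x ^ (1 - δ) ≤ h → h ≤ x → ∀ τ : G,
          |(Nat.card G : ℝ) * (fiberPsi 𝔪 f τ (x + h) - fiberPsi 𝔪 f τ x) -
              (h - (ψ₁ (Additive.ofMul τ)).re * (((x + h) ^ β₁ - x ^ β₁) / β₁))| ≤
            κ * min 1 ((1 - β₁) * Real.log x) * h := by
  obtain ⟨A, hA0, hA⟩ := Residue.residueLowerBound_all n
  obtain ⟨b, D, hb, hD, hdens⟩ := rayFam_density n hn A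
  obtain ⟨c₁, hc₁, hc₁1, hrep⟩ := rayRealZero_repulsion n hn
  have ha : (1 : ℝ) ≤ max A 4 / 4 := by
    rw [le_div_iff₀ (by norm_num)]; linarith [le_max_right A 4]
  obtain ⟨δ, a₂, c, hδ, hδ64, ha₂1, hc, hcn, hθ⟩ := fiberPsi_shortInterval_dichotomy_dh n hn hb hD ha hκ hc₁ hc₁1
  refine ⟨δ, a₂, c, hδ, hδ64, ha₂1, hc, hcn, fun K _ _ hKn G _ _ 𝔪 f h𝔪 hray hsep hG ↦ ?_⟩
  have hK : 1 < Module.finrank ℚ K := by rw [hKn]; exact hn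
  set R : ℝ := rayCondQ K 𝔪 with hR
  have hR12 : (12 : ℝ) ≤ R := twelve_le_rayCondQ hK h𝔪
  have hR1 : (1 : ℝ) ≤ R := by linarith
  have hR0 : (0 : ℝ) < R := by linarith
  have hRQ : R ≤ R ^ (4 : ℕ) := by
    calc R = R ^ 1 := (pow_one R).symm
      _ ≤ R ^ 4 := pow_le_pow_right₀ hR1 (by norm_num)
  have hG' : (Nat.card G : ℝ) ≤ (R ^ (4 : ℕ)) ^ (4 : ℕ) := by
    refine hG.trans ?_
    calc R ^ (4 : ℕ) = (R ^ 4) ^ 1 := (pow_one _).symm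
      _ ≤ (R ^ 4) ^ 4 := pow_le_pow_right₀ (one_le_pow₀ hR1) (by norm_num)
  have hκK : R ^ (-A) ≤ dedekindZeta_residue K := by
    refine le_trans ?_ (hA K hKn)
    have hQ0 : 0 < ThornerZaman.condQn K := by
      have := ThornerZaman.twelve_le_condQn (K := K) hK; linarith
    exact Real.rpow_le_rpow_of_nonpos hQ0 (condQn_le_rayCondQ h𝔪) (by linarith)
  have hlog4 : max A 4 / 4 * Real.log (R ^ (4 : ℕ)) = max A 4 * Real.log R := by
    rw [Real.log_pow]; push_cast; ring
  have hdens' : ∀ (T : ℝ), 1 ≤ T → ∀ u : AddChar (Additive G) ℂ → Finset ℂ,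
      (∀ ψ, ∀ ρ ∈ u ψ, rayFamF h𝔪 hray hsep ψ ρ = 0 ∧ 1 / 4 ≤ ρ.re ∧ ρ.re < 1 ∧ |ρ.im| ≤ T) →
      ∀ α : ℝ, α ≤ 1 →
        ∑ ψ, ∑ ρ ∈ u ψ with α ≤ ρ.re, (analyticOrderNatAt (rayFamF h𝔪 hray hsep ψ) ρ : ℝ) ≤
          D * Real.exp (b * (max A 4 / 4 * Real.log (R ^ (4 : ℕ)) + Real.log (T + 4))) ^ (1 - α) := by
    intro T hT u hu α hα
    rw [hlog4]
    exact hdens K hKn G 𝔪 f h𝔪 hray hsep hκK hG T hT u hu α hα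
  have hpow : (R ^ (4 : ℕ)) ^ (-(2 : ℝ)) = R ^ (-(8 : ℝ)) := by
    rw [← Real.rpow_natCast, ← Real.rpow_mul hR0.le]; norm_num
  have hrep' : ∀ ψ₁ : AddChar (Additive G) ℂ, ψ₁ + ψ₁ = 0 → ∀ β₁ : ℝ, β₁ < 1 →
      rayFamF h𝔪 hray hsep ψ₁ β₁ = 0 → c₁ * (R ^ (4 : ℕ)) ^ (-(2 : ℝ)) ≤ 1 - β₁ := by
    intro ψ₁ h1 β₁ hβ h0
    rw [hpow]; exact hrep K hKn G 𝔪 f h𝔪 hray hsep ψ₁ h1 β₁ hβ h0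
  exact hθ K hKn G 𝔪 f h𝔪 hray hsep (R ^ (4 : ℕ)) hRQ hG' hdens' hrep'

/-! ### A uniform lower bound in every short interval -/

set_option maxHeartbeats 800000 in
/-- **A uniform lower bound for every coset in every short interval of the Linnik range**: there are
`δ ∈ (0, 1/64]`, `a ≥ 1`, `c₂ ∈ (0, 1]` with `|G|(ψ_τ(x+h) − ψ_τ(x)) ≥ c₂ Q_𝔪^{−8} h` for `x ≥ Q_𝔪^{4a}`,
`x^{1−δ} ≤ h ≤ x`, every coset `τ` — unconditionally.  In the flat case `ψ₁(τ) = +1` this is Deuring–Heilbronn plus the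
repulsion `1 − β₁ ≥ c₁Q_𝔪^{−8}`; otherwise the bound is `≥ h/2`. [cite: LagariasMontgomeryOdlyzko1979, §7] -/
theorem fiberPsi_shortInterval_lower (n : ℕ) (hn : 1 < n) :
    ∃ δ a c₂ : ℝ, 0 < δ ∧ δ ≤ 1 / 64 ∧ 1 ≤ a ∧ 0 < c₂ ∧ c₂ ≤ 1 ∧
    ∀ (K : Type) [Field K] [NumberField K], Module.finrank ℚ K = n →
    ∀ (G : Type) [CommGroup G] [Finite G] (𝔪 : Ideal (𝓞 K)) (f : HeightOneSpectrum (𝓞 K) → G),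
      𝔪 ≠ ⊥ → ArtinKillsRay 𝔪 f →
      (∀ χ : AddChar (Additive G) ℂ, χ ≠ 0 →
        ∃ v : HeightOneSpectrum (𝓞 K), ¬ 𝔪 ≤ v.asIdeal ∧ χ (Additive.ofMul (f v)) ≠ 1) →
      (Nat.card G : ℝ) ≤ rayCondQ K 𝔪 ^ (4 : ℕ) →
      ∀ x h : ℝ, (rayCondQ K 𝔪 ^ (4 : ℕ)) ^ a ≤ x → x ^ (1 - δ) ≤ h → h ≤ x → ∀ τ : G,
        c₂ * rayCondQ K 𝔪 ^ (-(8 : ℝ)) * h ≤ (Nat.card G : ℝ) * (fiberPsi 𝔪 f τ (x + h) - fiberPsi 𝔪 f τ x) := by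
  obtain ⟨δ, a, c, hδ, hδ64, ha, hc, hcn, hmain⟩ := fiberPsi_shortInterval_dh_all n hn (by norm_num : (0 : ℝ) < 1 / 4)
  obtain ⟨c₁, hc₁, hc₁1, hrep⟩ := rayRealZero_repulsion n hn
  refine ⟨δ, a, c₁ / 4, hδ, hδ64, ha, by positivity, by linarith,
    fun K _ _ hKn G _ _ 𝔪 f h𝔪 hray hsep hG x h hx hhx hhx' τ ↦ ?_⟩
  have hK : 1 < Module.finrank ℚ K := by rw [hKn]; exact hn
  set R : ℝ := rayCondQ K 𝔪 with hR
  have hR12 : (12 : ℝ) ≤ R := twelve_le_rayCondQ hK h𝔪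
  have hR1 : (1 : ℝ) < R := by linarith
  have hR0 : (0 : ℝ) < R := by linarith
  have hR41 : (1 : ℝ) < R ^ (4 : ℕ) := one_lt_pow₀ hR1 (by norm_num)
  have hxR4 : R ^ (4 : ℕ) ≤ x := by
    have := (Real.rpow_le_rpow_of_exponent_le hR41.le ha).trans hx; rwa [Real.rpow_one] at this
  have hx1 : 1 < x := by linarith
  have hx0 : 0 < x := by linarith
  have hh0 : 0 ≤ h := le_trans (Real.rpow_nonneg hx0.le _) hhx
  have hRm8 : 0 < R ^ (-(8 : ℝ)) := Real.rpow_pos_of_pos hR0 _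
  have hRm8le : R ^ (-(8 : ℝ)) ≤ 1 := Real.rpow_le_one_of_one_le_of_nonpos hR1.le (by norm_num)
  have hm1 : c₁ * R ^ (-(8 : ℝ)) ≤ 1 := (mul_le_mul hc₁1 hRm8le hRm8.le zero_le_one).trans (by norm_num)
  have hmh : c₁ / 4 * R ^ (-(8 : ℝ)) * h ≤ h / 4 := by
    have := mul_le_mul_of_nonneg_right hm1 hh0; nlinarith
  have hlogx : 1 ≤ Real.log x := by
    have hR4R : R ≤ R ^ (4 : ℕ) := by
      calc R = R ^ 1 := (pow_one R).symm
        _ ≤ R ^ 4 := pow_le_pow_right₀ hR1.le (by norm_num)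
    have h12 : Real.log 12 ≤ Real.log x := Real.log_le_log (by norm_num) (by linarith)
    linarith [two_lt_log_twelve]
  rcases hmain K hKn G 𝔪 f h𝔪 hray hsep hG with hA | ⟨ψ₁, β₁, h0, hwin, hβ1, hreal, hB⟩
  · have key := (abs_le.1 (hA x h hx hhx hhx' τ)).1
    linarith
  · have key := (abs_le.1 (hB x h hx hhx hhx' τ)).1
    have hβhalf : 1 / 2 ≤ β₁ := by
      have hlog4 : 1 < Real.log 4 := by
        rw [show (4:ℝ) = 2 ^ 2 by norm_num, Real.log_pow]; have := Real.log_two_gt_d9; push_cast; linarith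
      have hlogd : 0 ≤ Real.log (((discr K).natAbs : ℝ) * ((Ideal.absNorm 𝔪 : ℕ) : ℝ)) :=
        Real.log_nonneg (one_le_discr_mul_absNorm K h𝔪)
      have hc2 : c ≤ 1 / 2 :=
        hcn.trans (by rw [div_le_div_iff_of_pos_left one_pos (by positivity) (by norm_num)]; nlinarith)
      have : c / (Real.log (((discr K).natAbs : ℝ) * ((Ideal.absNorm 𝔪 : ℕ) : ℝ)) + Real.log 4) ≤ 1 / 2 := by
        rw [div_le_iff₀ (by linarith)]; nlinarith
      linarith
    have hmin0 : 0 ≤ min 1 ((1 - β₁) * Real.log x) :=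
      le_min zero_le_one (mul_nonneg (by linarith) (by linarith))
    have hmin1 : min 1 ((1 - β₁) * Real.log x) ≤ 1 := min_le_left _ _
    have hI0 : 0 ≤ ((x + h) ^ β₁ - x ^ β₁) / β₁ := by
      refine div_nonneg ?_ (by linarith)
      have := Real.rpow_le_rpow hx0.le (show x ≤ x + h by linarith) (by linarith : 0 ≤ β₁)
      linarith
    -- `ψ₁(τ) = ±1`
    set r : ℝ := (ψ₁ (Additive.ofMul τ)).re with hr
    have hsq : ψ₁ (Additive.ofMul τ) * ψ₁ (Additive.ofMul τ) = 1 := by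
      have := DFunLike.congr_fun hreal (Additive.ofMul τ)
      rwa [AddChar.add_apply, AddChar.zero_apply] at this
    have hpm : ψ₁ (Additive.ofMul τ) = 1 ∨ ψ₁ (Additive.ofMul τ) = -1 := sq_eq_one_iff.mp (by rw [sq]; exact hsq)
    rcases hpm with h1 | h1
    · -- flat: `|G| Δψ ≥ (h − I) − (1/4) min · h ≥ (1/4)(h − I) ≥ (h/8) min ≥ (c₁/8) R^{-8} h`... use `half_min_mul_le_flat`
      have hr1 : r = 1 := by rw [hr, h1, Complex.one_re]
      rw [hr1, one_mul] at key
      have hfl := half_min_mul_le_flat hx1.le hh0 (by linarith) hβ1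
      have hδlow : c₁ * R ^ (-(8 : ℝ)) ≤ 1 - β₁ := hrep K hKn G 𝔪 f h𝔪 hray hsep ψ₁ hreal β₁ hβ1 h0
      have hμ : c₁ * R ^ (-(8 : ℝ)) ≤ min 1 ((1 - β₁) * Real.log x) := by
        refine le_min hm1 (hδlow.trans ?_)
        exact le_mul_of_one_le_right (by linarith) hlogx
      have h2 : c₁ / 4 * R ^ (-(8 : ℝ)) * h ≤ h / 4 * min 1 ((1 - β₁) * Real.log x) := by
        have := mul_le_mul_of_nonneg_right hμ hh0; nlinarith
      nlinarith
    · have hr1 : r = -1 := by rw [hr, h1, Complex.neg_re, Complex.one_re]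
      rw [hr1] at key
      have : 1 / 4 * min 1 ((1 - β₁) * Real.log x) * h ≤ h / 4 := by nlinarith
      nlinarith

/-! ### Prime ideals of every coset in every short interval -/

variable {K : Type} [Field K] [NumberField K]
variable {G : Type} [CommGroup G] {𝔪 : Ideal (𝓞 K)} {f : HeightOneSpectrum (𝓞 K) → G}

/-- `θ_τ(y) − θ_τ(x) > 0` (`x ≤ y`) produces a prime `𝔭 ∤ 𝔪` with `f 𝔭 = τ` and `x < N𝔭 ≤ y`. -/
theorem exists_prime_of_fiberTheta_sub_pos (τ : G) {x y : ℝ} (hxy : x ≤ y)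
    (hθ : 0 < fiberTheta 𝔪 f τ y - fiberTheta 𝔪 f τ x) :
    ∃ v : HeightOneSpectrum (𝓞 K), ¬ 𝔪 ≤ v.asIdeal ∧ f v = τ ∧ x < (Ideal.absNorm v.asIdeal : ℝ) ∧
      (Ideal.absNorm v.asIdeal : ℝ) ≤ y := by
  have hsub : (finite_primeIdealsLE K x).toFinset ⊆ (finite_primeIdealsLE K y).toFinset := by
    intro P hP
    rw [mem_primeIdealsLE_toFinset] at hP ⊢
    exact ⟨hP.1, hP.2.1, hP.2.2.trans hxy⟩
  have hdiff : fiberTheta 𝔪 f τ y - fiberTheta 𝔪 f τ x =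
      ∑ P ∈ (finite_primeIdealsLE K y).toFinset \ (finite_primeIdealsLE K x).toFinset,
        fiberIndicatorIdeal 𝔪 f τ P * Real.log (Ideal.absNorm P) := by
    unfold fiberTheta
    rw [← Finset.sum_sdiff hsub]; ring
  rw [hdiff] at hθ
  obtain ⟨P, hPmem, hne⟩ := Finset.exists_ne_zero_of_sum_ne_zero hθ.ne'
  rw [Finset.mem_sdiff, mem_primeIdealsLE_toFinset, mem_primeIdealsLE_toFinset] at hPmem
  obtain ⟨⟨hprime, hP0, hle⟩, hnot⟩ := hPmem
  have hind : P ≠ ⊥ ∧ IsCoprime P 𝔪 ∧ artinSymbol f P = τ := by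
    by_contra h
    apply hne
    unfold fiberIndicatorIdeal; rw [if_neg h, zero_mul]
  have hgt : x < (Ideal.absNorm P : ℝ) := by
    by_contra hle'
    exact hnot ⟨hprime, hP0, not_lt.1 hle'⟩
  set v : HeightOneSpectrum (𝓞 K) := ⟨P, hprime, hP0⟩ with hv
  refine ⟨v, fun hm ↦ ?_, ?_, hgt, hle⟩
  · have h := hind.2.1
    rw [Ideal.isCoprime_iff_sup_eq, sup_eq_left.2 hm] at h
    exact hprime.ne_top h
  · have := artinSymbol_asIdeal f v
    rw [hv] at this; dsimp only at this
    rw [← this]; exact hind.2.2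

set_option maxHeartbeats 1600000 in
/-- **Hoheisel–Linnik for the cosets of a congruence class group**: for `n > 1` there are `δ, L > 0` such that for
every `K` of degree `n`, every datum as above with `|G| ≤ Q_𝔪⁴`, every coset `τ`, every `x ≥ Q_𝔪^L` and every
`x^{1−δ} ≤ h ≤ x` there is a prime `𝔭 ∤ 𝔪` with `f 𝔭 = τ` and `x < N𝔭 ≤ x + h` — unconditionally.
[cite: LagariasMontgomeryOdlyzko1979, §7] [cite: Weiss1983, §6] -/
theorem exists_prime_fiber_absNorm_mem_Ioc (n : ℕ) (hn : 1 < n) :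
    ∃ δ L : ℝ, 0 < δ ∧ 0 < L ∧ ∀ (K : Type) [Field K] [NumberField K], Module.finrank ℚ K = n →
    ∀ (G : Type) [CommGroup G] [Finite G] (𝔪 : Ideal (𝓞 K)) (f : HeightOneSpectrum (𝓞 K) → G),
      𝔪 ≠ ⊥ → ArtinKillsRay 𝔪 f →
      (∀ χ : AddChar (Additive G) ℂ, χ ≠ 0 →
        ∃ v : HeightOneSpectrum (𝓞 K), ¬ 𝔪 ≤ v.asIdeal ∧ χ (Additive.ofMul (f v)) ≠ 1) →
      (Nat.card G : ℝ) ≤ rayCondQ K 𝔪 ^ (4 : ℕ) →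
      ∀ x h : ℝ, rayCondQ K 𝔪 ^ L ≤ x → x ^ (1 - δ) ≤ h → h ≤ x → ∀ τ : G,
        ∃ v : HeightOneSpectrum (𝓞 K), ¬ 𝔪 ≤ v.asIdeal ∧ f v = τ ∧ x < (Ideal.absNorm v.asIdeal : ℝ) ∧
          (Ideal.absNorm v.asIdeal : ℝ) ≤ x + h := by
  obtain ⟨δ, a, c₂, hδ, hδ64, ha, hc₂, hc₂1, hmain⟩ := fiberPsi_shortInterval_lower n hn
  obtain ⟨a₂, ha₂, habs⟩ := absorb_junk (8 / c₂) 1 (by positivity) one_pos le_rfl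
  refine ⟨δ, max (4 * a) (2 * a₂), hδ, by positivity, fun K _ _ hKn G _ _ 𝔪 f h𝔪 hray hsep hG x h hx hhx hhx' τ ↦ ?_⟩
  have hK : 1 < Module.finrank ℚ K := by rw [hKn]; exact hn
  set R : ℝ := rayCondQ K 𝔪 with hR
  have hR12 : (12 : ℝ) ≤ R := twelve_le_rayCondQ hK h𝔪
  have hR1 : (1 : ℝ) ≤ R := by linarith
  have hR0 : (0 : ℝ) < R := by linarith
  -- thresholds: `(R⁴)^a ≤ x` and `(R²)^{a₂} ≤ x`
  have hx4a : (R ^ (4 : ℕ)) ^ a ≤ x := by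
    refine le_trans ?_ hx
    rw [← Real.rpow_natCast, ← Real.rpow_mul hR0.le]
    exact Real.rpow_le_rpow_of_exponent_le hR1 (by push_cast; linarith [le_max_left (4 * a) (2 * a₂)])
  have hx2a : (R ^ (2 : ℕ)) ^ a₂ ≤ x := by
    refine le_trans ?_ hx
    rw [← Real.rpow_natCast, ← Real.rpow_mul hR0.le]
    exact Real.rpow_le_rpow_of_exponent_le hR1 (by push_cast; linarith [le_max_right (4 * a) (2 * a₂)])
  have hR2_12 : (12 : ℝ) ≤ R ^ (2 : ℕ) := by nlinarith
  have hxR : R ≤ x := by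
    have h1 : R ^ (1 : ℝ) ≤ R ^ max (4 * a) (2 * a₂) :=
      Real.rpow_le_rpow_of_exponent_le hR1 (by linarith [le_max_left (4 * a) (2 * a₂)])
    rw [Real.rpow_one] at h1; exact h1.trans hx
  have hx1 : 1 ≤ x := by linarith
  have hx0 : 0 < x := by linarith
  have hh0 : 0 < h := lt_of_lt_of_le (Real.rpow_pos_of_pos hx0 _) hhx
  have hlow := hmain K hKn G 𝔪 f h𝔪 hray hsep hG x h hx4a hhx hhx' τ
  -- the prime powers: `|G| (ψ_τ − θ_τ)(x+h) ≤ |G| · 2n √(x+h) log(x+h) ≤ (c₂/2) R^{-8} h`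
  have hG0 : (0 : ℝ) ≤ (Nat.card G : ℝ) := Nat.cast_nonneg _
  have hnR : (Module.finrank ℚ K : ℝ) ≤ R :=
    (ThornerZaman.finrank_le_condQn (K := K)).trans (condQn_le_rayCondQ h𝔪)
  have hpp : fiberPsi 𝔪 f τ (x + h) - fiberTheta 𝔪 f τ (x + h) ≤
      2 * Module.finrank ℚ K * Real.sqrt (x + h) * Real.log (x + h) := by
    refine (fiberPsi_sub_fiberTheta_le τ (by linarith : (0 : ℝ) ≤ x + h)).trans ?_
    refine (chebyshevPsiIdeal_sub_chebyshevThetaIdeal_le K (by linarith : (1 : ℝ) ≤ x + h)).trans ?_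
    exact mul_le_mul_of_nonneg_right (primeIdealCount_le_two_mul_finrank_mul K (Real.sqrt_nonneg _))
      (Real.log_nonneg (by linarith))
  have hθψ : fiberTheta 𝔪 f τ x ≤ fiberPsi 𝔪 f τ x := fiberTheta_le_fiberPsi τ x
  have hsqrt : Real.sqrt (x + h) ≤ 2 * x ^ ((1 : ℝ) / 2) := by
    rw [Real.sqrt_eq_rpow]
    have h1 : (x + h) ^ ((1 : ℝ) / 2) ≤ (4 * x) ^ ((1 : ℝ) / 2) :=
      Real.rpow_le_rpow (by linarith) (by linarith) (by norm_num)
    have h2 : (4 * x) ^ ((1 : ℝ) / 2) = 2 * x ^ ((1 : ℝ) / 2) := by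
      rw [Real.mul_rpow (by norm_num) hx0.le]
      congr 1
      rw [show (4 : ℝ) = 2 ^ (2 : ℕ) by norm_num, ← Real.rpow_natCast, ← Real.rpow_mul (by norm_num)]
      norm_num
    linarith
  have hlogxh : Real.log (x + h) ≤ Real.log x + 1 := by
    have h1 : Real.log (x + h) ≤ Real.log (2 * x) := Real.log_le_log (by linarith) (by linarith)
    rw [Real.log_mul (by norm_num) hx0.ne'] at h1
    have h2 : Real.log 2 < 0.6931471808 := Real.log_two_lt_d9
    linarith
  have hlog0 : 0 ≤ Real.log (x + h) := Real.log_nonneg (by linarith)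
  have hl1 : 0 ≤ Real.log x + 1 := by have := Real.log_nonneg hx1; linarith
  have habs' := habs (R ^ (2 : ℕ)) x hR2_12 hx2a
  -- `x^{1/2} = x^{−1/4}·x^{3/4}`, `x^{3/4} ≤ x^{1−δ} ≤ h`, `R¹³ ≤ (R²)⁷`, `R⁵ = R¹³ · R^{-8}`
  have hx34 : x ^ ((1 : ℝ) / 2) = x ^ (-((1 : ℝ) / 4)) * x ^ ((3 : ℝ) / 4) := by
    rw [← Real.rpow_add hx0]; norm_num
  have hx34h : x ^ ((3 : ℝ) / 4) ≤ h := (Real.rpow_le_rpow_of_exponent_le hx1 (by linarith)).trans hhx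
  have hRm8 : 0 < R ^ (-(8 : ℝ)) := Real.rpow_pos_of_pos hR0 _
  have hR13 : R ^ (13 : ℕ) ≤ (R ^ (2 : ℕ)) ^ (7 : ℕ) := by
    rw [← pow_mul]; exact pow_le_pow_right₀ hR1 (by norm_num)
  have hR5 : R ^ (5 : ℕ) = R ^ (13 : ℕ) * R ^ (-(8 : ℝ)) := by
    rw [show (R ^ (13 : ℕ) : ℝ) = R ^ (13 : ℝ) from (Real.rpow_natCast R 13).symm, ← Real.rpow_add hR0,
      show (R ^ (5 : ℕ) : ℝ) = R ^ (5 : ℝ) from (Real.rpow_natCast R 5).symm]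
    norm_num
  have hA : 4 * R ^ (13 : ℕ) * (Real.log x + 1) * x ^ ((1 : ℝ) / 2) ≤ c₂ / 2 * h := by
    rw [hx34]
    calc 4 * R ^ (13 : ℕ) * (Real.log x + 1) * (x ^ (-((1 : ℝ) / 4)) * x ^ ((3 : ℝ) / 4))
        ≤ 4 * (R ^ (2 : ℕ)) ^ (7 : ℕ) * (Real.log x + 1) * (x ^ (-((1 : ℝ) / 4)) * x ^ ((3 : ℝ) / 4)) := by
          gcongr
      _ = (c₂ / 2) * ((8 / c₂) * (R ^ (2 : ℕ)) ^ (7 : ℕ) * (Real.log x + 1) * x ^ (-((1 : ℝ) / 4))) *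
          x ^ ((3 : ℝ) / 4) := by
          field_simp; ring
      _ ≤ (c₂ / 2) * 1 * h := mul_le_mul (mul_le_mul_of_nonneg_left habs' (by positivity)) hx34h
          (by positivity) (by positivity)
      _ = c₂ / 2 * h := by ring
  have hkey : (Nat.card G : ℝ) * (2 * Module.finrank ℚ K * Real.sqrt (x + h) * Real.log (x + h)) ≤
      c₂ / 2 * R ^ (-(8 : ℝ)) * h := by
    calc (Nat.card G : ℝ) * (2 * Module.finrank ℚ K * Real.sqrt (x + h) * Real.log (x + h))
        ≤ R ^ (4 : ℕ) * (2 * R * (2 * x ^ ((1 : ℝ) / 2)) * (Real.log x + 1)) := by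
          refine mul_le_mul hG (mul_le_mul (mul_le_mul (by linarith) hsqrt (Real.sqrt_nonneg _) (by positivity))
            hlogxh hlog0 (by positivity)) (by positivity) (by positivity)
      _ = 4 * R ^ (5 : ℕ) * (Real.log x + 1) * x ^ ((1 : ℝ) / 2) := by ring
      _ = (4 * R ^ (13 : ℕ) * (Real.log x + 1) * x ^ ((1 : ℝ) / 2)) * R ^ (-(8 : ℝ)) := by rw [hR5]; ring
      _ ≤ (c₂ / 2 * h) * R ^ (-(8 : ℝ)) := mul_le_mul_of_nonneg_right hA hRm8.le
      _ = c₂ / 2 * R ^ (-(8 : ℝ)) * h := by ring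
  have hpp' := mul_le_mul_of_nonneg_left hpp hG0
  have hθψ' := mul_le_mul_of_nonneg_left hθψ hG0
  have hGpos : (0 : ℝ) < (Nat.card G : ℝ) := by
    exact_mod_cast Nat.card_pos (α := G)
  have hpos : 0 < fiberTheta 𝔪 f τ (x + h) - fiberTheta 𝔪 f τ x := by
    have h1 : 0 < c₂ / 2 * R ^ (-(8 : ℝ)) * h := by positivity
    have h2 : c₂ / 2 * R ^ (-(8 : ℝ)) * h ≤
        (Nat.card G : ℝ) * (fiberTheta 𝔪 f τ (x + h) - fiberTheta 𝔪 f τ x) := by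
      nlinarith [hlow, hkey, hpp', hθψ']
    exact pos_of_mul_pos_right (lt_of_lt_of_le h1 h2) hGpos.le
  exact exists_prime_of_fiberTheta_sub_pos τ (by linarith) hpos

/-- **Hoheisel–Linnik for narrow ray classes, unconditionally** (canonical case `G = Cl_K^𝔪`, `f = primeRayClass`):
for `n > 1` there are `δ, L > 0` such that for every number field `K` of degree `n`, every `𝔪 ≠ 0`, every narrow ray
class `τ mod 𝔪`, every `x ≥ (|d_K| n^n N𝔪)^L` and every `x^{1−δ} ≤ h ≤ x` there is a prime ideal `𝔭 ∤ 𝔪` in `τ` with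
`x < N𝔭 ≤ x + h`.  GRH-free, Siegel-free, no size hypothesis. [cite: LagariasMontgomeryOdlyzko1979, §7]
[cite: Weiss1983, §6] -/
theorem exists_prime_rayClass_absNorm_mem_Ioc (n : ℕ) (hn : 1 < n) :
    ∃ δ L : ℝ, 0 < δ ∧ 0 < L ∧ ∀ (K : Type) [Field K] [NumberField K], Module.finrank ℚ K = n →
    ∀ (𝔪 : Ideal (𝓞 K)) (h𝔪 : 𝔪 ≠ ⊥) (τ : RayClassGroup 𝔪) (x h : ℝ),
      rayCondQ K 𝔪 ^ L ≤ x → x ^ (1 - δ) ≤ h → h ≤ x →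
      ∃ v : HeightOneSpectrum (𝓞 K), ¬ 𝔪 ≤ v.asIdeal ∧ primeRayClass 𝔪 h𝔪 v = τ ∧
        x < (Ideal.absNorm v.asIdeal : ℝ) ∧ (Ideal.absNorm v.asIdeal : ℝ) ≤ x + h := by
  obtain ⟨δ, L, hδ, hL, h⟩ := exists_prime_fiber_absNorm_mem_Ioc n hn
  refine ⟨δ, L, hδ, hL, fun K _ _ hKn 𝔪 h𝔪 τ x h' hx hhx hhx' ↦ ?_⟩
  haveI : Finite (RayClassGroup 𝔪) := finite_rayClassGroup h𝔪
  have hK : 1 < Module.finrank ℚ K := by rw [hKn]; exact hn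
  exact h K hKn (RayClassGroup 𝔪) 𝔪 (primeRayClass 𝔪 h𝔪) h𝔪 (artinKillsRay_primeRayClass h𝔪)
    (fun χ hχ ↦ exists_charFun_primeRayClass_ne_one h𝔪 χ hχ) (natCard_rayClassGroup_le_rayCondQ_pow hK h𝔪)
    x h' hx hhx hhx' τ

end Summit.QuantumAdvantage.QuantumAdvantage.Theorems.DegreeOnePrimesEscape

end
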